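import Summits.CriticalPhenomena.PercolationContinuityZ3.Theorems.FK.InfiniteVolumeBoxLaws
import Literature.Probability.LatticeModels.FKIsingAnnulusCrossingProofs
import HarnessLib

/-!
# FK-continuity transplant, FO-06 (construction half): existence and uniqueness of the free and
# wired infinite-volume random-cluster measures `φ⁰_{p,q}`, `φ¹_{p,q}` on `ℤ^d` (Grimmett Thm. (4.19)(a))

Cell `fk-continuity` (bschramm), row FO-06 seat B; support file for the FK-continuity transplant
(`--supports stmt-CriticalPhenomena-4575`); builds on p205010 (kernel theorem, internal audit signed;
external expert review pending). No named facts, no sorries, standard axioms. General dimension `d`.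

> **Theorem (4.19)(a)** (Grimmett 2006). Let `p ∈ [0,1]`, `q ≥ 1`, `b ∈ {0,1}`. The weak limits
> `φ^b_{p,q} = lim_{Λ ↑ ℤ^d} φ^b_{Λ,p,q}` exist (along the boxes `Λ_n = [-n,n]^d`).

In the vocabulary of `InfiniteVolumeDefs.lean`: for `0 ≤ p ≤ 1`, `q ≥ 1` and each boundary condition
`b` (`false` = free, `true` = wired) there is exactly one probability measure `P` on the bond
configurations of `ℤ^d` with `IsBoxLimit d b p q P` (`exists_isBoxLimit`, `IsBoxLimit.unique`), and
`rcLimit d b p q` is it (`isBoxLimit_rcLimit`, `IsBoxLimit.eq_rcLimit`). Proof: the increasing-cylinder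
probabilities of the box laws converge (`InfiniteVolumeBoxLaws.lean`, Grimmett's (4.24)), hence all
local-event probabilities do and Kolmogorov's theorem packages the limits into a measure
(`InfiniteVolumeCylinders.lean` over the tree's `LocalLimitMeasure.lean`); uniqueness because local
events generate. This is the general-`d`, both-boundary-conditions form of the tree's `d = 2` free
result `Literature.Probability.Percolation.exists_isFreeRandomClusterLimit`.

First properties of the limits recorded here (all for `0 ≤ p ≤ 1`, `q ≥ 1`):
* real-valued convergence on local events (`IsBoxLimit.tendsto_real`);
* support: `φ^b_{p,q}`-a.s. every open pair is an edge of `ℤ^d` (`IsBoxLimit.ae_subset_edgeSet`);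
* **free ≤ wired on increasing local events** (`IsBoxLimit.real_le_of_isUpperSet`; Grimmett 2006
  Lemma (4.14)(b) in each box, `rcMeasure_real_mono_wired_of_isUpperSet`, passed to the limit);
* **edge densities**: `φ⁰_{p,q}(e open) = h⁰(p,q)(e)` and `φ¹_{p,q}(e open) = h¹(p,q)(e)` — the limits
  give the tree's limiting edge densities `freeEdgeDensity`/`wiredEdgeDensity` of
  `RandomClusterShiftedBoxes.lean` (Grimmett 2006, (4.61)) their meaning as one-edge marginals
  (`IsBoxLimit.real_setOf_mem_eq_freeEdgeDensity`, `…_eq_wiredEdgeDensity`);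
* dimension `0`: the free and wired limits coincide (`isBoxLimit_iff_false_of_eq_zero`, `rcLimit_eq_false_of_eq_zero`).

## References

* G. Grimmett, *The Random-Cluster Model*, Springer 2006: §4.2 (4.11)–(4.12), Lemma (4.14)(b),
  Thm. (4.19)(a) and its proof, eq. (4.24); (4.61). [Grimmett2006]
-/

noncomputable section

open MeasureTheory Set Filter
open scoped Topology ENNReal

namespace Summit.CriticalPhenomena.PercolationContinuityZ3.Theorems.FK

open Literature.Probability.Percolation Literature.Probability.LatticeModels

variable {d : ℕ}

/-! ### Existence and uniqueness (Grimmett 2006, Thm. (4.19)(a)) -/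

/-- **Grimmett 2006, Thm. (4.19)(a) — existence of `φ^b_{p,q}` on `ℤ^d`**: for `0 ≤ p ≤ 1`, `q ≥ 1`
and either boundary condition `b`, the box laws `φ^b_{Λ_n,p,q}` converge on every local event to a
probability measure on the bond configurations of `ℤ^d`. [cite: Grimmett2006, Thm. (4.19)(a)] -/
theorem exists_isBoxLimit (b : Bool) {p q : ℝ} (hp : p ∈ Set.Icc (0 : ℝ) 1) (hq : 1 ≤ q) :
    ∃ P : Measure (BondConfig (Site d)), IsBoxLimit d b p q P := by
  haveI : ∀ n, IsProbabilityMeasure (rcBoxLaw d b p q n) := fun n =>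
    isProbabilityMeasure_rcBoxLaw b hp (one_pos.trans_le hq) n
  obtain ⟨P, hP, hlim⟩ := exists_measure_tendsto_of_tendsto_supset (rcBoxLaw d b p q)
    (tendsto_rcBoxLaw_real_setOf_subset b hp hq)
  exact ⟨P, ⟨hP, hlim⟩⟩

/-- **Uniqueness of the box limit**: local events generate, so two box limits with the same
parameters coincide. [cite: Grimmett2006, Thm. (4.19)(a) (weak limits are determined by cylinder events)] -/
theorem IsBoxLimit.unique {b : Bool} {p q : ℝ} {P P' : Measure (BondConfig (Site d))}
    (hP : IsBoxLimit d b p q P) (hP' : IsBoxLimit d b p q P') : P = P' := by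
  haveI := hP.isProbabilityMeasure
  exact measure_unique_of_tendsto_isLocalEvent (rcBoxLaw d b p q) hP.tendsto_of_isLocalEvent
    hP'.tendsto_of_isLocalEvent

/-- **`rcLimit d b p q` is the infinite-volume measure `φ^b_{p,q}`** for `0 ≤ p ≤ 1`, `q ≥ 1`.
[cite: Grimmett2006, Thm. (4.19)(a)] -/
theorem isBoxLimit_rcLimit (b : Bool) {p q : ℝ} (hp : p ∈ Set.Icc (0 : ℝ) 1) (hq : 1 ≤ q) :
    IsBoxLimit d b p q (rcLimit d b p q) :=
  isBoxLimit_rcLimit_of_exists (exists_isBoxLimit b hp hq)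

/-- Any box limit is `rcLimit`. [cite: Grimmett2006, Thm. (4.19)(a)] -/
theorem IsBoxLimit.eq_rcLimit {b : Bool} {p q : ℝ} {P : Measure (BondConfig (Site d))}
    (hP : IsBoxLimit d b p q P) : P = rcLimit d b p q :=
  hP.unique (isBoxLimit_rcLimit_of_exists ⟨P, hP⟩)

/-- Existence and uniqueness in one statement. [cite: Grimmett2006, Thm. (4.19)(a)] -/
theorem existsUnique_isBoxLimit (b : Bool) {p q : ℝ} (hp : p ∈ Set.Icc (0 : ℝ) 1) (hq : 1 ≤ q) :
    ∃! P : Measure (BondConfig (Site d)), IsBoxLimit d b p q P :=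
  ⟨rcLimit d b p q, isBoxLimit_rcLimit b hp hq, fun _ hP => hP.eq_rcLimit⟩

/-- `rcLimit d b p q` is always a probability measure (the box limit when it exists, a Dirac mass
otherwise). [folklore] -/
theorem isProbabilityMeasure_rcLimit (b : Bool) (p q : ℝ) :
    IsProbabilityMeasure (rcLimit d b p q) := by
  classical
  by_cases h : ∃ P : Measure (BondConfig (Site d)), IsBoxLimit d b p q P
  · exact (isBoxLimit_rcLimit_of_exists h).isProbabilityMeasure
  · rw [rcLimit, dif_neg h]
    infer_instance

/-! ### Convergence in real-valued form; dimension `0` -/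

/-- Real-valued convergence on local events: `φ^b_{Λ_n,p,q}(A) → P(A)` in `ℝ`. [cite: Grimmett2006, Thm. (4.19)(a)] -/
theorem IsBoxLimit.tendsto_real {b : Bool} {p q : ℝ} {P : Measure (BondConfig (Site d))}
    (hP : IsBoxLimit d b p q P) {A : Set (BondConfig (Site d))} (hA : IsLocalEvent A) :
    Tendsto (fun n => (rcBoxLaw d b p q n).real A) atTop (𝓝 (P.real A)) := by
  haveI := hP.isProbabilityMeasure
  exact (ENNReal.tendsto_toReal (measure_ne_top P A)).comp (hP.tendsto_of_isLocalEvent A hA)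

/-- In dimension `0` (one-point lattice, no edges, empty wired boundary) being a wired box limit is
the same as being a free box limit. [folklore] -/
theorem isBoxLimit_iff_false_of_eq_zero (hd : d = 0) (b : Bool) (p q : ℝ)
    (P : Measure (BondConfig (Site d))) : IsBoxLimit d b p q P ↔ IsBoxLimit d false p q P := by
  constructor
  · rintro ⟨hP, hlim⟩
    refine ⟨hP, fun A hA => ?_⟩
    simpa only [rcBoxLaw_eq_false_of_eq_zero hd] using hlim A hA
  · rintro ⟨hP, hlim⟩
    refine ⟨hP, fun A hA => ?_⟩
    simpa only [rcBoxLaw_eq_false_of_eq_zero hd] using hlim A hA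

/-- In dimension `0`, `φ¹_{p,q} = φ⁰_{p,q}` (indeed all `rcLimit 0 b p q` agree). [folklore] -/
theorem rcLimit_eq_false_of_eq_zero (hd : d = 0) (b : Bool) (p q : ℝ) :
    rcLimit d b p q = rcLimit d false p q := by
  classical
  by_cases h : ∃ P : Measure (BondConfig (Site d)), IsBoxLimit d false p q P
  · have hb : IsBoxLimit d b p q (rcLimit d false p q) :=
      (isBoxLimit_iff_false_of_eq_zero hd b p q _).2 (isBoxLimit_rcLimit_of_exists h)
    exact hb.eq_rcLimit.symm
  · have hb : ¬ ∃ P : Measure (BondConfig (Site d)), IsBoxLimit d b p q P := fun ⟨P, hP⟩ =>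
      h ⟨P, (isBoxLimit_iff_false_of_eq_zero hd b p q P).1 hP⟩
    rw [rcLimit, rcLimit, dif_neg h, dif_neg hb]

/-! ### Support: almost surely only lattice edges are open -/

/-- A pair which is not an edge of `ℤ^d` is open with probability `0` under every box law (the
random-cluster measure lives on edge sets, and lattice edges of the box lift to lattice edges).
[cite: Grimmett2006, §1.2, eq. (1.2)] -/
theorem rcBoxLaw_setOf_mem_eq_zero_of_notMem (b : Bool) {p q : ℝ} (hp : p ∈ Set.Icc (0 : ℝ) 1)
    (hq : 0 < q) (n : ℕ) {e : Sym2 (Site d)} (he : e ∉ (zdGraph d).edgeSet) :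
    rcBoxLaw d b p q n {ω | e ∈ ω} = 0 := by
  haveI := isProbabilityMeasure_rcBoxLaw b hp hq n (d := d)
  rw [← measureReal_eq_zero_iff, rcBoxLaw_real_apply b p q n (measurableSet_mem e)]
  refine le_antisymm ?_ measureReal_nonneg
  have h := rcMeasure_real_mono_on_edgeSets (finsetGraph (zdGraph d) (box d n)) hp hq (boxBC d b n)
    (A := liftEdges (box d n) ⁻¹' {ω | e ∈ ω}) (A' := ∅) fun ω hω hmem => ?_
  · rwa [measureReal_empty] at h
  · obtain ⟨e', he', rfl⟩ := (mem_liftEdges_iff.1 hmem :)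
    refine he ?_
    have he'E := hω he'
    induction e' using Sym2.ind with
    | h u v => exact (SimpleGraph.mem_edgeSet _).2 ((finsetGraph_adj_iff u v).1 he'E)

/-- **Support of the limits**: `φ^b_{p,q}`-almost surely only edges of `ℤ^d` are open.
[cite: Grimmett2006, §4.2 (Ω = {0,1}^{E^d})] -/
theorem IsBoxLimit.ae_subset_edgeSet {b : Bool} {p q : ℝ} {P : Measure (BondConfig (Site d))}
    (hP : IsBoxLimit d b p q P) (hp : p ∈ Set.Icc (0 : ℝ) 1) (hq : 0 < q) :
    ∀ᵐ ω ∂P, ω ⊆ (zdGraph d).edgeSet :=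
  ae_subset_of_measure_setOf_mem_eq_zero P _ fun _ he =>
    measure_setOf_mem_eq_zero_of_tendsto hP.tendsto_of_isLocalEvent fun n =>
      rcBoxLaw_setOf_mem_eq_zero_of_notMem b hp hq n he

/-! ### Free ≤ wired on increasing local events (Grimmett 2006, Lemma (4.14)(b) in the limit) -/

/-- In each box, the free law is dominated by the wired law on increasing events: `φ⁰_{Λ_n}(A) ≤
φ¹_{Λ_n}(A)` (`0 ≤ p ≤ 1`, `q ≥ 1`). [cite: Grimmett2006, Lemma (4.14)(b)] -/
theorem rcBoxLaw_real_false_le_true {p q : ℝ} (hp : p ∈ Set.Icc (0 : ℝ) 1) (hq : 1 ≤ q)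
    {A : Set (BondConfig (Site d))} (hA : IsUpperSet A) (hAm : MeasurableSet A) (n : ℕ) :
    (rcBoxLaw d false p q n).real A ≤ (rcBoxLaw d true p q n).real A := by
  rw [rcBoxLaw_real_apply _ _ _ _ hAm, rcBoxLaw_real_apply _ _ _ _ hAm, rcBoxMeasure_false,
    rcBoxMeasure_true]
  exact rcMeasure_real_mono_wired_of_isUpperSet _ hp hq (Set.empty_subset _)
    (hA.preimage (liftEdges_mono _))

/-- **`φ⁰_{p,q}(A) ≤ φ¹_{p,q}(A)` for every increasing local event `A`** (`0 ≤ p ≤ 1`, `q ≥ 1`).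
[cite: Grimmett2006, Lemma (4.14)(b) and Thm. (4.19)(a)] -/
theorem IsBoxLimit.real_le_of_isUpperSet {p q : ℝ} {P₀ P₁ : Measure (BondConfig (Site d))}
    (h₀ : IsBoxLimit d false p q P₀) (h₁ : IsBoxLimit d true p q P₁) (hp : p ∈ Set.Icc (0 : ℝ) 1)
    (hq : 1 ≤ q) {A : Set (BondConfig (Site d))} (hA : IsLocalEvent A) (hAu : IsUpperSet A) :
    P₀.real A ≤ P₁.real A :=
  le_of_tendsto_of_tendsto' (h₀.tendsto_real hA) (h₁.tendsto_real hA) fun n =>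
    rcBoxLaw_real_false_le_true hp hq hAu (measurableSet_of_isLocalEvent_holds hA) n

/-- The same for the canonical limits: `(rcLimit d false p q)(A) ≤ (rcLimit d true p q)(A)` on
increasing local events. [cite: Grimmett2006, Lemma (4.14)(b) and Thm. (4.19)(a)] -/
theorem rcLimit_real_false_le_true {p q : ℝ} (hp : p ∈ Set.Icc (0 : ℝ) 1) (hq : 1 ≤ q)
    {A : Set (BondConfig (Site d))} (hA : IsLocalEvent A) (hAu : IsUpperSet A) :
    (rcLimit d false p q).real A ≤ (rcLimit d true p q).real A :=
  (isBoxLimit_rcLimit false hp hq).real_le_of_isUpperSet (isBoxLimit_rcLimit true hp hq) hp hq hA hAu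

/-! ### One-edge marginals are the tree's limiting edge densities (Grimmett 2006, (4.61)) -/

/-- The box law of "`e` is open" is the box measure of the tree's edge event `J_e = eOpen`.
[cite: Grimmett2006, (4.61)] -/
theorem rcBoxLaw_real_setOf_mem (b : Bool) (p q : ℝ) (n : ℕ) (e : Sym2 (Site d)) :
    (rcBoxLaw d b p q n).real {ω | e ∈ ω} = (rcBoxMeasure d b p q n).real (eOpen (box d n) e) := by
  rw [rcBoxLaw_real_apply b p q n (measurableSet_mem e)]
  rfl

/-- Free: `φ⁰_{Λ_n}(e open)` is the tree's `boxFreeEdgeProb`. [cite: Grimmett2006, (4.61)] -/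
theorem rcBoxLaw_false_real_setOf_mem (p q : ℝ) (n : ℕ) (e : Sym2 (Site d)) :
    (rcBoxLaw d false p q n).real {ω | e ∈ ω} = boxFreeEdgeProb d p q e n :=
  rcBoxLaw_real_setOf_mem false p q n e

/-- Wired: `φ¹_{Λ_n}(e open)` is the tree's `boxWiredEdgeProb`. [cite: Grimmett2006, (4.61)] -/
theorem rcBoxLaw_true_real_setOf_mem (p q : ℝ) (n : ℕ) (e : Sym2 (Site d)) :
    (rcBoxLaw d true p q n).real {ω | e ∈ ω} = boxWiredEdgeProb d p q e n :=
  rcBoxLaw_real_setOf_mem true p q n e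

/-- **`φ⁰_{p,q}(e open) = h⁰(p,q)(e)`**: the one-edge marginal of the free limit is the tree's
limiting free edge density (`0 ≤ p ≤ 1`, `q ≥ 1`). [cite: Grimmett2006, (4.61) with Thm. (4.19)(a)] -/
theorem IsBoxLimit.real_setOf_mem_eq_freeEdgeDensity {p q : ℝ} {P : Measure (BondConfig (Site d))}
    (hP : IsBoxLimit d false p q P) (hp : p ∈ Set.Icc (0 : ℝ) 1) (hq : 1 ≤ q) (e : Sym2 (Site d)) :
    P.real {ω | e ∈ ω} = freeEdgeDensity d p q e := by
  refine tendsto_nhds_unique (hP.tendsto_real (isLocalEvent_setOf_mem e)) ?_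
  simp_rw [rcBoxLaw_false_real_setOf_mem]
  exact tendsto_boxFreeEdgeProb hp hq e

/-- **`φ¹_{p,q}(e open) = h¹(p,q)(e)`**: the one-edge marginal of the wired limit is the tree's
limiting wired edge density (`d ≥ 1`, `0 ≤ p ≤ 1`, `q ≥ 1`). [cite: Grimmett2006, (4.61) with Thm. (4.19)(a)] -/
theorem IsBoxLimit.real_setOf_mem_eq_wiredEdgeDensity (hd : 0 < d) {p q : ℝ}
    {P : Measure (BondConfig (Site d))} (hP : IsBoxLimit d true p q P) (hp : p ∈ Set.Icc (0 : ℝ) 1)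
    (hq : 1 ≤ q) (e : Sym2 (Site d)) : P.real {ω | e ∈ ω} = wiredEdgeDensity d p q e := by
  refine tendsto_nhds_unique (hP.tendsto_real (isLocalEvent_setOf_mem e)) ?_
  simp_rw [rcBoxLaw_true_real_setOf_mem]
  exact tendsto_boxWiredEdgeProb hd hp hq e

end Summit.CriticalPhenomena.PercolationContinuityZ3.Theorems.FK

end
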